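import Literature.NumberTheory.EllipticCurves.QuadraticTwistNegOneRootNumberProofs
import Literature.NumberTheory.EllipticCurves.QuadraticTwistOddValuationReductionProofs
import HarnessLib

/-!
# `aₙ(E^{(±2)}) = χ(n) aₙ(E)` and the root numbers of the twists by `±2`, from the Modularity Theorem

Let `E/ℚ` be an elliptic curve (any model `W`) with **good reduction at `2`** and odd conductor `N`, and let
`E^{(2)} = W.quadraticTwist 2`, `E^{(−2)} = W.quadraticTwist (−2)` be its quadratic twists by `ℚ(√2)`
and `ℚ(√−2)` (Kronecker characters `(8/·) = χ₈` and `(−8/·) = χ₈'`, Mathlib's `ZMod.χ₈`, `ZMod.χ₈'`,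
both primitive of conductor `8`). Companion of `QuadraticTwistNegOneLFunctionProofs` /
`QuadraticTwistNegOneRootNumberProofs` (the twist by `−1`, character `χ₄`). This file PROVES:

* `LFunction_quadraticTwist_two_apply`, `LFunction_quadraticTwist_neg_two_apply`:
  `aₙ(E^{(2)}) = χ₈(n) aₙ(E)` and `aₙ(E^{(−2)}) = χ₈'(n) aₙ(E)` for all `n ≥ 1` (Silverman, *AEC* X.2
  Prop. 2.4, X.5 Cor. 5.4, Exercise 10.16; Murty–Murty 1997, Ch. 6 §1, `L_D(s, f)` with `D = ±8`), place by
  place for Mathlib's Euler product: at an odd place `v ∤ d` the local factor of `E^{(d)}` is that of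
  `E` rescaled by the Legendre symbol `(d/ℓ)` (`localEulerFactor_quadraticTwist_intCast_of_not_dvd`, from
  the tree's `localEulerFactor_quadraticTwist`), and `(±2/ℓ) = χ₈(ℓ), χ₈'(ℓ)` (`jacobiSym.at_two`,
  `jacobiSym.at_neg_two`); at the place over `2` the twist is **additive** — automatic here, since
  `ord₂(±2) = 1` is odd and `E` is good at `2` (`hasAdditiveReductionAt_quadraticTwist_of_valuation_eq_exp_odd`
  of `QuadraticTwistOddValuationReductionProofs`) — so its local factor is `1`, matching `χ(2ᵏ) = 0`;
* `rootNumber_quadraticTwist_two`, `rootNumber_quadraticTwist_neg_two`: **`w(E^{(2)}) = χ₈(N) w(E)`,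
  `w(E^{(−2)}) = −χ₈'(N) w(E)`** and `N_{E^{(±2)}} = 64 N`, from the Modularity Theorem `exists_isNewformOf`
  alone, by the coprime twisting theorem `rootNumber_eq_of_cuspCoeff_eq_twist`
  (`TwistRootNumberModularityProofs`; Murty–Murty 1997, Ch. 6 §1: sign `ω χ_D(−N)` for `(D, N) = 1`;
  Atkin–Lehner 1970, §6) with the primitive quadratic characters `χ₈ ⊗ ℂ`, `χ₈' ⊗ ℂ` mod `8`;
* `rootNumber_quadraticTwist_neg_two_eq_neg`, `…_eq_of_mod_four_eq_three`: hence
  **`w(E^{(−2)}) = −w(E^{(2)})` if `N ≡ 1 (mod 4)`** and `w(E^{(−2)}) = w(E^{(2)})` if `N ≡ 3 (mod 4)`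
  (`χ₈' = χ₄ χ₈`). The first case is the mechanism behind the root-number sentence of Bhargava–Shankar,
  Ann. of Math. 181 (2015), §4.1, on their family `F` (`BSDRankZeroFamilyRootNumberProofs`).

Declarations are placed in `namespace WeierstrassCurve` as deliberate dot-notation extensions of the Mathlib
namespace (like the sibling twist files) and in `Literature.NumberTheory.EllipticCurves.ModularForms` for the
Dirichlet characters. Everything is proved; no definitions and no named facts are introduced (D-0026).

## References

* [SilvermanAEC2009] J. H. Silverman, *The Arithmetic of Elliptic Curves*, 2nd ed. 2009, VII.5 Prop. 5.1,
  X.2 Prop. 2.4, X.5 Cor. 5.4, Exercise 10.16.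
* [MurtyMurty1997] M. R. Murty, V. K. Murty, *Non-vanishing of `L`-functions and applications* (1997),
  Ch. 6, §1.
* [AtkinLehner1970] A. O. L. Atkin, J. Lehner, *Hecke operators on `Γ₀(m)`*, Math. Ann. 185 (1970), §6.
-/

noncomputable section

open scoped Classical NumberTheorySymbols

namespace Literature.NumberTheory.EllipticCurves.ModularForms

/-- The values of `χ₈ ⊗ ℂ` at naturals are those of Mathlib's `ZMod.χ₈`. [folklore] -/
theorem χ₈_ringHomComp_apply_natCast (n : ℕ) :
    (ZMod.χ₈.ringHomComp (Int.castRingHom ℂ)) n = (ZMod.χ₈ n : ℂ) := by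
  rw [MulChar.ringHomComp_apply]
  rfl

/-- The values of `χ₈' ⊗ ℂ` at naturals are those of Mathlib's `ZMod.χ₈'`. [folklore] -/
theorem χ₈'_ringHomComp_apply_natCast (n : ℕ) :
    (ZMod.χ₈'.ringHomComp (Int.castRingHom ℂ)) n = (ZMod.χ₈' n : ℂ) := by
  rw [MulChar.ringHomComp_apply]
  rfl

/-- `χ₈ ⊗ ℂ` is even: `χ₈(−1) = 1`. [folklore] -/
theorem χ₈_ringHomComp_neg_one : (ZMod.χ₈.ringHomComp (Int.castRingHom ℂ)) (-1) = 1 := by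
  rw [MulChar.ringHomComp_apply]
  have h : ZMod.χ₈ (-1) = 1 := by decide
  rw [h]
  simp

/-- `χ₈' ⊗ ℂ` is odd: `χ₈'(−1) = −1`. [folklore] -/
theorem χ₈'_ringHomComp_neg_one : (ZMod.χ₈'.ringHomComp (Int.castRingHom ℂ)) (-1) = -1 := by
  rw [MulChar.ringHomComp_apply]
  have h : ZMod.χ₈' (-1) = -1 := by decide
  rw [h]
  simp

/-- `χ₈ ⊗ ℂ` is a quadratic character. [folklore] -/
theorem isQuadratic_χ₈_ringHomComp : (ZMod.χ₈.ringHomComp (Int.castRingHom ℂ)).IsQuadratic :=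
  ZMod.isQuadratic_χ₈.comp _

/-- `χ₈' ⊗ ℂ` is a quadratic character. [folklore] -/
theorem isQuadratic_χ₈'_ringHomComp : (ZMod.χ₈'.ringHomComp (Int.castRingHom ℂ)).IsQuadratic :=
  ZMod.isQuadratic_χ₈'.comp _

/-- A Dirichlet character mod `8` with `χ(5) = −1` is primitive (its conductor divides `8 = 2³` but
not `4`, since `5 ≡ 1 (mod 4)`). [folklore] -/
theorem isPrimitive_of_apply_five_eq_neg_one (χ : DirichletCharacter ℂ 8) (h5 : χ (5 : ℤ) = -1) :
    χ.IsPrimitive := by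
  rw [DirichletCharacter.isPrimitive_def]
  have hdvd : χ.conductor ∣ 2 ^ 3 := χ.conductor_dvd_level
  have hnot : ¬ χ.conductor ∣ 4 := by
    intro h4
    have hmem : 4 ∈ χ.conductorSet :=
      (χ.mem_conductorSet_iff_conductor_dvd (show 4 ∣ 8 by norm_num)).mpr h4
    obtain ⟨hd, χ₀, hχ₀⟩ := (χ.mem_conductorSet_iff.mp hmem)
    have hcop : IsCoprime (5 : ℤ) (8 : ℕ) := by
      rw [Int.isCoprime_iff_gcd_eq_one]; decide
    have h5' : χ (5 : ℤ) = χ₀ (5 : ℤ) := by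
      rw [hχ₀, DirichletCharacter.changeLevel_eq_cast_of_dvd' χ₀ hd hcop]
    have h51 : ((5 : ℤ) : ZMod 4) = 1 := by decide
    rw [h5, h51, map_one] at h5'
    norm_num at h5'
  obtain ⟨k, hk, hk'⟩ := (Nat.dvd_prime_pow Nat.prime_two).mp hdvd
  interval_cases k
  · exact absurd (hk' ▸ one_dvd 4) hnot
  · exact absurd (hk' ▸ (show 2 ∣ 4 by norm_num)) hnot
  · exact absurd (hk' ▸ dvd_refl 4) hnot
  · rw [hk']; norm_num

/-- `χ₈ ⊗ ℂ` is primitive of conductor `8`. [folklore] -/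
theorem isPrimitive_χ₈_ringHomComp :
    DirichletCharacter.IsPrimitive (ZMod.χ₈.ringHomComp (Int.castRingHom ℂ)) := by
  refine isPrimitive_of_apply_five_eq_neg_one _ ?_
  rw [MulChar.ringHomComp_apply]
  have h : ZMod.χ₈ ((5 : ℤ) : ZMod 8) = -1 := by decide
  rw [h]
  simp

/-- `χ₈' ⊗ ℂ` is primitive of conductor `8`. [folklore] -/
theorem isPrimitive_χ₈'_ringHomComp :
    DirichletCharacter.IsPrimitive (ZMod.χ₈'.ringHomComp (Int.castRingHom ℂ)) := by
  refine isPrimitive_of_apply_five_eq_neg_one _ ?_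
  rw [MulChar.ringHomComp_apply]
  have h : ZMod.χ₈' ((5 : ℤ) : ZMod 8) = -1 := by decide
  rw [h]
  simp


/-- `χ₈'(N) = χ₈(N)` for `N ≡ 1 (mod 4)` (both are `1` at `N ≡ 1` and `−1` at `N ≡ 5 (mod 8)`;
`χ₈' = χ₄ χ₈`). [folklore] -/
theorem χ₈'_eq_χ₈_of_mod_four_eq_one {N : ℕ} (hN : N % 4 = 1) : ZMod.χ₈' N = ZMod.χ₈ N := by
  rw [ZMod.χ₈_nat_eq_if_mod_eight, ZMod.χ₈'_nat_eq_if_mod_eight]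
  split_ifs <;> omega

/-- `χ₈'(N) = −χ₈(N)` for `N ≡ 3 (mod 4)` (`χ₈' = χ₄ χ₈` and `χ₄(N) = −1`). [folklore] -/
theorem χ₈'_eq_neg_χ₈_of_mod_four_eq_three {N : ℕ} (hN : N % 4 = 3) : ZMod.χ₈' N = -ZMod.χ₈ N := by
  rw [ZMod.χ₈_nat_eq_if_mod_eight, ZMod.χ₈'_nat_eq_if_mod_eight]
  split_ifs <;> omega

end Literature.NumberTheory.EllipticCurves.ModularForms

namespace WeierstrassCurve

open IsDedekindDomain IsDedekindDomain.HeightOneSpectrum NumberField Rat.HeightOneSpectrum IsLocalRing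
  Literature.NumberTheory.EllipticCurves Literature.NumberTheory.EllipticCurves.ModularForms

variable (W : WeierstrassCurve ℚ) [W.IsElliptic]

/-! ### The local factor of `E^{(d)}` at an odd place not dividing `d` -/

/-- **The local factor of `E^{(d)}` (`d ∈ ℤ`) at an odd place `v ∤ d`** (prime `ℓ`): it is the
rescaling by the Legendre symbol `(d / ℓ)` of that of `E` — `d` is an `ℓ`-adic unit, a square mod `ℓ`
iff `(d / ℓ) = 1` (`localEulerFactor_quadraticTwist`). [folklore] -/
theorem localEulerFactor_quadraticTwist_intCast_of_not_dvd (d : ℤ) (v : HeightOneSpectrum (𝓞 ℚ))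
    (hv2 : (primesEquiv v : ℕ) ≠ 2) (hvd : ¬ ((primesEquiv v : ℕ) : ℤ) ∣ d) :
    ((W.quadraticTwist (d : ℚ)).baseChange (v.adicCompletion ℚ)).localEulerFactor
        (v.adicCompletionIntegers ℚ) =
      ArithmeticFunction.ofPowerSeries (primesEquiv v : ℕ)
        (PowerSeries.rescale (J(d | (primesEquiv v : ℕ)))
          ((W.baseChange (v.adicCompletion ℚ)).localPowerSeries (v.adicCompletionIntegers ℚ))) := by
  haveI := Fact.mk (primesEquiv v).2
  haveI : NeZero (2 : v.adicCompletion ℚ) := ⟨by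
    rw [← map_ofNat (algebraMap ℚ (v.adicCompletion ℚ)) 2]; exact (map_ne_zero _).mpr two_ne_zero⟩
  haveI : (W.baseChange (v.adicCompletion ℚ)).IsElliptic := by
    change (W.map _).IsElliptic; infer_instance
  set ℓ : ℕ := (primesEquiv v : ℕ) with hℓ
  have hℓp : ℓ.Prime := (primesEquiv v).2
  have hℓ2 : ¬ (ℓ : ℤ) ∣ 2 := by
    intro h
    have := (Nat.prime_dvd_prime_iff_eq hℓp Nat.prime_two).mp (Int.natCast_dvd_natCast.mp h)
    exact hv2 this
  have hu := isUnit_adicCompletionIntegers_intCast v hvd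
  have h2 : IsUnit (2 : v.adicCompletionIntegers ℚ) := by
    have := isUnit_adicCompletionIntegers_intCast v hℓ2
    simpa using this
  -- the twist at `v`
  have htw : (W.quadraticTwist (d : ℚ)).baseChange (v.adicCompletion ℚ) =
      (W.baseChange (v.adicCompletion ℚ)).quadraticTwist
        (algebraMap (v.adicCompletionIntegers ℚ) (v.adicCompletion ℚ) hu.unit) := by
    rw [baseChange, map_quadraticTwist, IsUnit.unit_spec, algebraMap_adicCompletionIntegers_intCast]
    rfl
  rw [htw, localEulerFactor_quadraticTwist (v.adicCompletionIntegers ℚ) h2 _ hu.unit,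
    natCard_residueField_adicCompletionIntegers v]
  congr 2
  -- the sign: `d` is a square in the residue field iff `(d / ℓ) = 1`
  obtain ⟨e, he⟩ := exists_residueField_ringEquiv_zmod v
  have hsq : IsSquare (residue _ ((hu.unit : (v.adicCompletionIntegers ℚ)ˣ) : v.adicCompletionIntegers ℚ)) ↔
      IsSquare ((d : ZMod ℓ)) := by
    rw [IsUnit.unit_spec, ← isSquare_ringEquiv_iff e.toMulEquiv, RingEquiv.toMulEquiv_eq_coe,
      RingEquiv.coe_toMulEquiv, he]
  have hd0 : (d : ZMod ℓ) ≠ 0 := by rwa [Ne, ZMod.intCast_zmod_eq_zero_iff_dvd]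
  simp only [hsq]
  rw [← jacobiSym.legendreSym.to_jacobiSym]
  congr 1
  split_ifs with h
  · exact ((legendreSym.eq_one_iff ℓ hd0).mpr h).symm
  · exact ((legendreSym.eq_neg_one_iff ℓ).mpr h).symm

/-! ### The global identity for a twist ramified only at `2` -/

/-- **`aₙ(E^{(d)}) = ε(n) aₙ(E)` for `d` divisible by no odd prime**, where `ε` is a completely
multiplicative function vanishing at the even numbers with `ε(ℓ) = (d / ℓ)` at odd primes `ℓ`, provided
the twist `E^{(d)}` has additive reduction at the place over `2` (local factor `1` there). The cases of
interest are `d = 2`, `ε = χ₈` and `d = −2`, `ε = χ₈'`. [cite: SilvermanAEC2009, X.5 Cor. 5.4 and Exercise 10.16] -/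
theorem LFunction_quadraticTwist_intCast_apply_of_forall_not_dvd {d : ℤ}
    (hd : ∀ ℓ : ℕ, ℓ.Prime → ℓ ≠ 2 → ¬ (ℓ : ℤ) ∣ d) (ε : ℕ → ℤ) (hε1 : ε 1 = 1)
    (hεmul : ∀ m n, ε (m * n) = ε m * ε n) (hε2 : ∀ k : ℕ, k ≠ 0 → ε (2 ^ k) = 0)
    (hεodd : ∀ ℓ : ℕ, ℓ.Prime → ℓ ≠ 2 → J(d | ℓ) = ε ℓ)
    (hadd : ∀ v : HeightOneSpectrum (𝓞 ℚ), (primesEquiv v : ℕ) = 2 →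
      (W.quadraticTwist (d : ℚ)).HasAdditiveReductionAt v)
    (n : ℕ) : (W.quadraticTwist (d : ℚ)).LFunction n = ε n * W.LFunction n := by
  rw [LFunction_eq_eulerProduct, LFunction_eq_eulerProduct]
  refine ArithmeticFunction.eulerProduct_apply_eq_mul_of_forall (P := fun _ ↦ True)
    (fun _ _ _ ↦ ⟨trivial, trivial⟩) ε hε1 hεmul _ _ (fun v m _ ↦ ?_)
    (eventually_cofinite_localEulerFactor_apply _) (eventually_cofinite_localEulerFactor_apply _) trivial
  haveI := Fact.mk (primesEquiv v).2
  have hℓ1 : 1 < (primesEquiv v : ℕ) := (primesEquiv v).2.one_lt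
  by_cases hv2 : (primesEquiv v : ℕ) = 2
  · -- the place over `2`: the factor of the twist is trivial and `ε(2^k) = 0`
    rw [localEulerFactor_eq_one_of_hasAdditiveReduction _ (hadd v hv2), ArithmeticFunction.one_apply]
    split_ifs with hm1
    · rw [hm1, localEulerFactor_apply_one, hε1, one_mul]
    · by_cases hpow : ∃ k, Nat.card (ResidueField (v.adicCompletionIntegers ℚ)) ^ k = m
      · obtain ⟨k, rfl⟩ := hpow
        rw [natCard_residueField_adicCompletionIntegers] at hm1 ⊢
        have hk : k ≠ 0 := fun h ↦ hm1 (by rw [h, pow_zero])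
        rw [hv2, hε2 k hk, zero_mul]
      · rw [localEulerFactor_apply_eq_zero _ _ (by rwa [natCard_residueField_adicCompletionIntegers]) hpow,
          mul_zero]
  · -- an odd place: `ℓ ∤ d`
    have hvd : ¬ ((primesEquiv v : ℕ) : ℤ) ∣ d := hd _ (primesEquiv v).2 hv2
    rw [W.localEulerFactor_quadraticTwist_intCast_of_not_dvd d v hv2 hvd, localEulerFactor,
      natCard_residueField_adicCompletionIntegers, hεodd _ (primesEquiv v).2 hv2]
    exact ArithmeticFunction.ofPowerSeries_rescale_apply hℓ1 ε hε1 hεmul _ m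

/-- An odd prime does not divide `±2`. [folklore] -/
theorem not_dvd_two_of_prime_ne_two {ℓ : ℕ} (hℓ : ℓ.Prime) (hℓ2 : ℓ ≠ 2) : ¬ (ℓ : ℤ) ∣ 2 := by
  intro h
  exact hℓ2 ((Nat.prime_dvd_prime_iff_eq hℓ Nat.prime_two).mp (Int.natCast_dvd_natCast.mp h))

/-- **`aₙ(E^{(2)}) = χ₈(n) aₙ(E)` for all `n`** (the twist by `ℚ(√2)`, Kronecker character `(8/·) = χ₈`),
for an elliptic curve `E / ℚ` whose twist `E^{(2)}` is additive at the place over `2` (automatic when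
`E` has good reduction at `2`, `hasAdditiveReductionAt_quadraticTwist_of_valuation_eq_exp_odd`).
[cite: SilvermanAEC2009, X.5 Cor. 5.4 and Exercise 10.16] -/
theorem LFunction_quadraticTwist_two_apply
    (hadd : ∀ v : HeightOneSpectrum (𝓞 ℚ), (primesEquiv v : ℕ) = 2 →
      (W.quadraticTwist 2).HasAdditiveReductionAt v)
    (n : ℕ) : (W.quadraticTwist 2).LFunction n = ZMod.χ₈ n * W.LFunction n := by
  have h := W.LFunction_quadraticTwist_intCast_apply_of_forall_not_dvd (d := 2)
    (fun ℓ hℓ hℓ2 ↦ not_dvd_two_of_prime_ne_two hℓ hℓ2) (fun n : ℕ ↦ (ZMod.χ₈ n : ℤ)) (by simp)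
    (fun m n ↦ by rw [Nat.cast_mul, map_mul]) (fun k hk ↦ ?_) (fun ℓ hℓ hℓ2 ↦ ?_)
    (by exact_mod_cast hadd) n
  · exact_mod_cast h
  · rw [ZMod.χ₈_nat_eq_if_mod_eight, if_pos]
    obtain ⟨j, rfl⟩ := Nat.exists_eq_succ_of_ne_zero hk
    rw [pow_succ, Nat.mul_mod_left]
  · exact jacobiSym.at_two (hℓ.odd_of_ne_two hℓ2)

/-- **`aₙ(E^{(−2)}) = χ₈'(n) aₙ(E)` for all `n`** (the twist by `ℚ(√−2)`, Kronecker character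
`(−8/·) = χ₈'`), for an elliptic curve `E / ℚ` whose twist `E^{(−2)}` is additive at the place over `2`.
[cite: SilvermanAEC2009, X.5 Cor. 5.4 and Exercise 10.16] -/
theorem LFunction_quadraticTwist_neg_two_apply
    (hadd : ∀ v : HeightOneSpectrum (𝓞 ℚ), (primesEquiv v : ℕ) = 2 →
      (W.quadraticTwist (-2)).HasAdditiveReductionAt v)
    (n : ℕ) : (W.quadraticTwist (-2)).LFunction n = ZMod.χ₈' n * W.LFunction n := by
  have h := W.LFunction_quadraticTwist_intCast_apply_of_forall_not_dvd (d := -2)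
    (fun ℓ hℓ hℓ2 h ↦ not_dvd_two_of_prime_ne_two hℓ hℓ2 (dvd_neg.mp h)) (fun n : ℕ ↦ (ZMod.χ₈' n : ℤ))
    (by simp) (fun m n ↦ by rw [Nat.cast_mul, map_mul]) (fun k hk ↦ ?_) (fun ℓ hℓ hℓ2 ↦ ?_)
    (by exact_mod_cast hadd) n
  · exact_mod_cast h
  · rw [ZMod.χ₈'_nat_eq_if_mod_eight, if_pos]
    obtain ⟨j, rfl⟩ := Nat.exists_eq_succ_of_ne_zero hk
    rw [pow_succ, Nat.mul_mod_left]
  · exact jacobiSym.at_neg_two (hℓ.odd_of_ne_two hℓ2)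

/-- The complex form of `LFunction_quadraticTwist_two_apply`, with `χ₈ ⊗ ℂ` (the form consumed by
`rootNumber_eq_of_cuspCoeff_eq_twist`). [cite: SilvermanAEC2009, X.5 Cor. 5.4 and Exercise 10.16] -/
theorem LFunction_quadraticTwist_two_apply_complex
    (hadd : ∀ v : HeightOneSpectrum (𝓞 ℚ), (primesEquiv v : ℕ) = 2 →
      (W.quadraticTwist 2).HasAdditiveReductionAt v)
    (n : ℕ) :
    (((W.quadraticTwist 2).LFunction n : ℤ) : ℂ) =
      (ZMod.χ₈.ringHomComp (Int.castRingHom ℂ)) n * (W.LFunction n : ℂ) := by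
  rw [W.LFunction_quadraticTwist_two_apply hadd n, Int.cast_mul, χ₈_ringHomComp_apply_natCast]

/-- The complex form of `LFunction_quadraticTwist_neg_two_apply`, with `χ₈' ⊗ ℂ`.
[cite: SilvermanAEC2009, X.5 Cor. 5.4 and Exercise 10.16] -/
theorem LFunction_quadraticTwist_neg_two_apply_complex
    (hadd : ∀ v : HeightOneSpectrum (𝓞 ℚ), (primesEquiv v : ℕ) = 2 →
      (W.quadraticTwist (-2)).HasAdditiveReductionAt v)
    (n : ℕ) :
    (((W.quadraticTwist (-2)).LFunction n : ℤ) : ℂ) =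
      (ZMod.χ₈'.ringHomComp (Int.castRingHom ℂ)) n * (W.LFunction n : ℂ) := by
  rw [W.LFunction_quadraticTwist_neg_two_apply hadd n, Int.cast_mul, χ₈'_ringHomComp_apply_natCast]


/-! ### The root numbers of `E^{(±2)}` for `E` good at `2`, from the Modularity Theorem -/

/-- **The twists `E^{(±2)}` of a curve with good reduction at `2` are additive at `2`** (`ord₂(±2) = 1` is
odd: `hasAdditiveReductionAt_quadraticTwist_of_valuation_eq_exp_odd`; Silverman VII.5 Prop. 5.1).
[cite: SilvermanAEC2009, VII.5 Prop. 5.1] -/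
theorem hasAdditiveReductionAt_quadraticTwist_two_of_hasGoodReductionAt
    (hgood : ∀ w : HeightOneSpectrum (𝓞 ℚ), natGenerator w = 2 → W.HasGoodReductionAt w)
    (v : HeightOneSpectrum (𝓞 ℚ)) (hv : (primesEquiv v : ℕ) = 2) :
    (W.quadraticTwist 2).HasAdditiveReductionAt v ∧ (W.quadraticTwist (-2)).HasAdditiveReductionAt v := by
  have h2 : v.valuation ℚ (2 : ℚ) = WithZero.exp (-((1 : ℕ) : ℤ)) := by
    have h := valuation_ringOfIntegers_natCast_primesEquiv v
    rw [hv] at h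
    exact_mod_cast h
  have h2' : v.valuation ℚ (-2 : ℚ) = WithZero.exp (-((1 : ℕ) : ℤ)) := by
    rw [Valuation.map_neg, h2]
  exact ⟨W.hasAdditiveReductionAt_quadraticTwist_of_valuation_eq_exp_odd v odd_one h2 (hgood v hv),
    W.hasAdditiveReductionAt_quadraticTwist_of_valuation_eq_exp_odd v odd_one h2' (hgood v hv)⟩

/-- An odd natural number is coprime to `8`. [folklore] -/
theorem coprime_eight_of_not_two_dvd {N : ℕ} (hN2 : ¬ 2 ∣ N) : N.Coprime 8 := by
  have h2 : N.Coprime 2 := (Nat.prime_two.coprime_iff_not_dvd.mpr hN2).symm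
  have := h2.pow_right 3
  norm_num at this
  exact this

/-- **Root number and conductor of `E^{(2)}` for `E` good at `2` with odd conductor `N`**
(Murty–Murty 1997, Ch. 6 §1 with `D = 8`: sign `ω χ_8(−N) = ω χ₈(N)`; Atkin–Lehner 1970, §6):
`w(E^{(2)}) = χ₈(N) w(E)` and `N_{E^{(2)}} = 64 N`, from the Modularity Theorem.
[cite: MurtyMurty1997, Ch. 6 §1] [cite: AtkinLehner1970, §6] -/
theorem rootNumber_quadraticTwist_two (hmod : exists_isNewformOf) (hN2 : ¬ 2 ∣ W.conductorNorm ℤ)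
    (hgood : ∀ w : HeightOneSpectrum (𝓞 ℚ), natGenerator w = 2 → W.HasGoodReductionAt w) :
    (W.quadraticTwist 2).rootNumber = ZMod.χ₈ (W.conductorNorm ℤ) * W.rootNumber ∧
      (W.quadraticTwist 2).conductorNorm ℤ = 64 * W.conductorNorm ℤ := by
  haveI : (W.quadraticTwist (2 : ℚ)).IsElliptic := W.isElliptic_quadraticTwist two_ne_zero
  haveI : NeZero (8 : ℕ) := ⟨by norm_num⟩
  have h := rootNumber_eq_of_cuspCoeff_eq_twist W hmod (coprime_eight_of_not_two_dvd hN2)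
    isQuadratic_χ₈_ringHomComp isPrimitive_χ₈_ringHomComp (W.quadraticTwist 2)
    (W.LFunction_quadraticTwist_two_apply_complex fun v hv ↦
      (W.hasAdditiveReductionAt_quadraticTwist_two_of_hasGoodReductionAt hgood v hv).1)
  refine ⟨?_, by rw [h.2]; ring⟩
  have h1 := h.1
  rw [χ₈_ringHomComp_neg_one, mul_one, χ₈_ringHomComp_apply_natCast] at h1
  have h' : (((W.quadraticTwist 2).rootNumber : ℤ) : ℂ) =
      ((ZMod.χ₈ (W.conductorNorm ℤ) * W.rootNumber : ℤ) : ℂ) := by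
    rw [h1]; push_cast; ring
  exact_mod_cast h'

/-- **Root number and conductor of `E^{(−2)}` for `E` good at `2` with odd conductor `N`**
(Murty–Murty 1997, Ch. 6 §1 with `D = −8`: sign `ω χ_{−8}(−N) = −ω χ₈'(N)`; Atkin–Lehner 1970, §6):
`w(E^{(−2)}) = −χ₈'(N) w(E)` and `N_{E^{(−2)}} = 64 N`, from the Modularity Theorem.
[cite: MurtyMurty1997, Ch. 6 §1] [cite: AtkinLehner1970, §6] -/
theorem rootNumber_quadraticTwist_neg_two (hmod : exists_isNewformOf) (hN2 : ¬ 2 ∣ W.conductorNorm ℤ)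
    (hgood : ∀ w : HeightOneSpectrum (𝓞 ℚ), natGenerator w = 2 → W.HasGoodReductionAt w) :
    (W.quadraticTwist (-2)).rootNumber = -ZMod.χ₈' (W.conductorNorm ℤ) * W.rootNumber ∧
      (W.quadraticTwist (-2)).conductorNorm ℤ = 64 * W.conductorNorm ℤ := by
  haveI : (W.quadraticTwist (-2 : ℚ)).IsElliptic := W.isElliptic_quadraticTwist (by norm_num)
  haveI : NeZero (8 : ℕ) := ⟨by norm_num⟩
  have h := rootNumber_eq_of_cuspCoeff_eq_twist W hmod (coprime_eight_of_not_two_dvd hN2)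
    isQuadratic_χ₈'_ringHomComp isPrimitive_χ₈'_ringHomComp (W.quadraticTwist (-2))
    (W.LFunction_quadraticTwist_neg_two_apply_complex fun v hv ↦
      (W.hasAdditiveReductionAt_quadraticTwist_two_of_hasGoodReductionAt hgood v hv).2)
  refine ⟨?_, by rw [h.2]; ring⟩
  have h1 := h.1
  rw [χ₈'_ringHomComp_neg_one, χ₈'_ringHomComp_apply_natCast] at h1
  have h' : (((W.quadraticTwist (-2)).rootNumber : ℤ) : ℂ) =
      ((-ZMod.χ₈' (W.conductorNorm ℤ) * W.rootNumber : ℤ) : ℂ) := by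
    rw [h1]; push_cast; ring
  exact_mod_cast h'

/-- **`N ≡ 1 (mod 4)`: the twists by `2` and by `−2` have opposite root numbers**,
`w(E^{(−2)}) = −w(E^{(2)})` (`−χ₈'(N) = −χ₈(N)`; Murty–Murty 1997, Ch. 6 §1). This is the mechanism of the
root-number sentence of Bhargava–Shankar §4.1 on their family. [cite: MurtyMurty1997, Ch. 6 §1] -/
theorem rootNumber_quadraticTwist_neg_two_eq_neg (hmod : exists_isNewformOf)
    (hN : W.conductorNorm ℤ % 4 = 1)
    (hgood : ∀ w : HeightOneSpectrum (𝓞 ℚ), natGenerator w = 2 → W.HasGoodReductionAt w) :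
    (W.quadraticTwist (-2)).rootNumber = -(W.quadraticTwist 2).rootNumber := by
  have hN2 : ¬ 2 ∣ W.conductorNorm ℤ := by omega
  rw [(W.rootNumber_quadraticTwist_two hmod hN2 hgood).1, (W.rootNumber_quadraticTwist_neg_two hmod hN2 hgood).1,
    χ₈'_eq_χ₈_of_mod_four_eq_one hN]
  ring

/-- **`N ≡ 3 (mod 4)`: the twists by `2` and by `−2` have the same root number**,
`w(E^{(−2)}) = w(E^{(2)})` (`−χ₈'(N) = χ₈(N)`; Murty–Murty 1997, Ch. 6 §1). [cite: MurtyMurty1997, Ch. 6 §1] -/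
theorem rootNumber_quadraticTwist_neg_two_eq_of_mod_four_eq_three (hmod : exists_isNewformOf)
    (hN : W.conductorNorm ℤ % 4 = 3)
    (hgood : ∀ w : HeightOneSpectrum (𝓞 ℚ), natGenerator w = 2 → W.HasGoodReductionAt w) :
    (W.quadraticTwist (-2)).rootNumber = (W.quadraticTwist 2).rootNumber := by
  have hN2 : ¬ 2 ∣ W.conductorNorm ℤ := by omega
  rw [(W.rootNumber_quadraticTwist_two hmod hN2 hgood).1, (W.rootNumber_quadraticTwist_neg_two hmod hN2 hgood).1,
    χ₈'_eq_neg_χ₈_of_mod_four_eq_three hN]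
  ring

end WeierstrassCurve

end
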